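import Summits.ABC.ABC.Theses.RibetTakahashiSplit
import Summits.ABC.ABC.Theorems.RibetTakahashiSplitFewPrimeValuationProductOfParts
import Summits.ABC.ABC.Theorems.RibetTakahashiSplitFewPrimeValuationProductStubNonfaceOfHardCore
import Summits.ABC.ABC.Theorems.RibetTakahashiSplitFewPrimeValuationProductFreyOfCrux
import Summits.ABC.ABC.Theorems.RibetTakahashiSplitFewPrimeValuationProductHardCoreOfFrey
import Summits.ABC.ABC.Theorems.RibetTakahashiSplitFewPrimeValuationProductSubexpFour
import Summits.ABC.ABC.Theorems.RibetTakahashiSplitFewPrimeValuationProductStubLflInput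
import HarnessLib

/-!
# The few-prime item `FewPrimeValuationProduct` decomposed by name: hard core, four-prime sub-exponential abc, residual

Support file (`--supports stmt-ABC-1563`) for the item
`Summit.ABC.ABC.Theses.RibetTakahashiSplit.FewPrimeValuationProduct` (r4 of route `RibetTakahashiSplit`:
`T(E) := ∏_{p ∥ N} ord_p Δ_min(E) ≤ C_ε N^ε` for `E/ℚ` semistable away from `2` with `≤ 3` odd multiplicative
primes). It lands the registered sub-goals that were still open after the two lead sessions of the line
`matveev-face-clearing` — all of them compositions of LANDED theorems. The hard-core statement below is,
verbatim, the route's crux decl `Summit.ABC.ABC.Theses.RibetTakahashiSplit.FewPrimeHardCore` (item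
stmt-ABC-15197), and the last section restates the decomposition against that decl BY NAME
(`fewPrimeHardCore_of_fewPrimeValuationProduct`, `fewPrimeValuationProduct_of_lfl_of_fewPrimeHardCore_of_residual`,
`fewPrimeValuationProduct_iff_fewPrimeHardCore_and_residual`, and the reading from the unproved named fact
`Dioph.evertseGyory_thm_4_2_1_rat`, CONDITIONAL on it), so that the dependency between the two items is
kernel-checked: no proof of stmt-ABC-1563 avoids stmt-ABC-15197.

* `hardCore_of_fewPrimeValuationProduct` — NECESSITY: the item implies the hard core
  (`freyFewPrime_of_fewPrimeValuationProduct`, `hardCore_of_freyFewPrime`).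
* `freyFewPrime_of_lfl_of_hardCore` — SUFFICIENCY on the Frey class: the LFL input (Matveev + Yu in Pasten's
  form) clears the power-of-two face (`stub_faceBound`, `face_rpow_of_polylog`), the hard core gives every
  non-face triple (`stub_nonfaceOfHardCore`), and `frey_of_face_of_nonface` is excluded middle.
* `fewPrimeValuationProduct_of_lfl_of_hardCore_of_residual` — the item from LFL ∧ hard core ∧ the non-Frey
  residual (`crux_of_frey_of_residual`, the numerical Frey dictionary).
* `subexpFour_of_fewPrimeValuationProduct`, `nonFreyResidual_of_fewPrimeValuationProduct`,
  `fewPrimeValuationProduct_of_subexpFour_of_residual`, `fewPrimeValuationProduct_iff_subexpFour_and_residual` —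
  the UNCONDITIONAL decomposition `FewPrimeValuationProduct ⟺ SubexpABC|_{ω(abc) ≤ 4} ∧ NonFreyResidual`
  (no LFL input: sub-exponential abc on four-prime triples absorbs the face); modulo the LFL input this is
  `FewPrimeValuationProduct ⟺ FewPrimeHardCore ∧ NonFreyResidual`.

Here `NonFreyResidual` is the item verbatim on the curves of its class admitting no numerical Frey shadow
(no abc triple whose odd primes are multiplicative for `W` and whose doubled exponents dominate the component
orders at the primes `p ∥ N`), and `SubexpABC|_{ω ≤ 4}` is `∀ ε > 0 ∃ κ, log c ≤ κ · rad(abc)^ε` on abc triples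
with `≤ 4` prime factors. Both conjuncts of either decomposition are open (abc/Szpiro strength on their
classes); nothing in this file is a proof of the item.

## References

* H. Pasten, *Shimura curves and the abc conjecture*, J. Number Theory 254 (2024) = arXiv:1705.09251, §16
  (the valuation product `∏ v_p(Δ)` and Conj. 1.14). [PastenShimura2024]
* H. Pasten, *The largest prime factor of `n² + 1` and improvements on subexponential ABC*, Invent. Math. 236
  (2024), Thm 2.1 (the LFL input in the form `PastenApproximationBound`). [Pasten2024]
* J.-H. Evertse, K. Győry, *Unit Equations in Diophantine Number Theory*, CUP 2015, Thm 4.2.1.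
-/

-- `Summit.<Summit>.<Problem>`: for the single-conjunct summit `ABC` the duplicate `ABC.ABC` is mandated.
set_option linter.dupNamespace false

noncomputable section

namespace Summit.ABC.ABC.Theorems.FewPrimeValuationProduct

open scoped BigOperators
open Finset
open Literature.NumberTheory.DiophantineGeometry

/-! ## The Frey class: face ∨ non-face -/

/-- **The Frey part from the face and the non-face bounds**: `∏_{p ∣ abc} v_p(abc) ≤ K_ε rad^ε` on every abc
triple supported on `≤ 4` primes, by excluded middle on "some member is a power of two" (the skeleton glue of
the line `matveev-face-clearing`, re-homed). [folklore] -/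
theorem frey_of_face_of_nonface
    (hface : ∀ ε : ℝ, 0 < ε → ∃ C : ℝ, ∀ a b c : ℕ, IsABCTriple a b c → (a * b * c).primeFactors.card ≤ 4 →
      ((∃ j : ℕ, a = 2 ^ j) ∨ (∃ j : ℕ, b = 2 ^ j) ∨ (∃ j : ℕ, c = 2 ^ j)) →
      ((∏ p ∈ (a * b * c).primeFactors, (a * b * c).factorization p : ℕ) : ℝ) ≤ C * (rad a b c : ℝ) ^ ε)
    (hnon : ∀ ε : ℝ, 0 < ε → ∃ C : ℝ, ∀ a b c : ℕ, IsABCTriple a b c → (a * b * c).primeFactors.card ≤ 4 →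
      ¬ ((∃ j : ℕ, a = 2 ^ j) ∨ (∃ j : ℕ, b = 2 ^ j) ∨ (∃ j : ℕ, c = 2 ^ j)) →
      ((∏ p ∈ (a * b * c).primeFactors, (a * b * c).factorization p : ℕ) : ℝ) ≤ C * (rad a b c : ℝ) ^ ε) :
    ∀ ε : ℝ, 0 < ε → ∃ K : ℝ, ∀ a b c : ℕ, IsABCTriple a b c → (a * b * c).primeFactors.card ≤ 4 →
      ((∏ p ∈ (a * b * c).primeFactors, (a * b * c).factorization p : ℕ) : ℝ) ≤ K * (rad a b c : ℝ) ^ ε := by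
  intro ε hε
  obtain ⟨C₁, hC₁⟩ := hface ε hε
  obtain ⟨C₂, hC₂⟩ := hnon ε hε
  refine ⟨max C₁ C₂, fun a b c habc hcard => ?_⟩
  have hrad0 : (0 : ℝ) ≤ (rad a b c : ℝ) := Nat.cast_nonneg _
  have hrε : 0 ≤ (rad a b c : ℝ) ^ ε := Real.rpow_nonneg hrad0 ε
  by_cases hf : (∃ j : ℕ, a = 2 ^ j) ∨ (∃ j : ℕ, b = 2 ^ j) ∨ (∃ j : ℕ, c = 2 ^ j)
  · exact (hC₁ a b c habc hcard hf).trans (mul_le_mul_of_nonneg_right (le_max_left _ _) hrε)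
  · exact (hC₂ a b c habc hcard hf).trans (mul_le_mul_of_nonneg_right (le_max_right _ _) hrε)

/-- **Sufficiency on the Frey class (registered sub-goal `freyFewPrime_of_lfl_of_hardCore`).** From the LFL
input `∃ K ≥ 1, PastenApproximationBound K` (Matveev + Yu over `ℚ` in Pasten's form) and the hard-core bound
`x·y·z·k ≤ C_ε (2pqr)^ε` on the solutions of `±p^x ± q^y ± 2^k r^z = 0` in distinct odd primes, every abc
triple with `≤ 4` prime factors has `∏_{p ∣ abc} v_p(abc) ≤ K_ε rad^ε`: the face by `stub_faceBound` and
`face_rpow_of_polylog`, the non-face triples by `stub_nonfaceOfHardCore`. [folklore] -/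
theorem freyFewPrime_of_lfl_of_hardCore :
    (∃ K : ℝ, 1 ≤ K ∧ Literature.NumberTheory.DiophantineGeometry.Dioph.PastenApproximationBound K) → (∀ ε : ℝ, 0 < ε → ∃ C : ℝ, ∀ p q r x y z k : ℕ, p.Prime → q.Prime → r.Prime → Odd p → Odd q → Odd r → p ≠ q → p ≠ r → q ≠ r → 0 < x → 0 < y → 0 < z → 0 < k → (p ^ x + q ^ y = 2 ^ k * r ^ z ∨ p ^ x + 2 ^ k * r ^ z = q ^ y ∨ q ^ y + 2 ^ k * r ^ z = p ^ x) → ((x * y * z * k : ℕ) : ℝ) ≤ C * ((2 * p * q * r : ℕ) : ℝ) ^ ε) → ∀ ε : ℝ, 0 < ε → ∃ K : ℝ, ∀ a b c : ℕ, Literature.NumberTheory.DiophantineGeometry.IsABCTriple a b c → (a * b * c).primeFactors.card ≤ 4 → ((∏ p ∈ (a * b * c).primeFactors, (a * b * c).factorization p : ℕ) : ℝ) ≤ K * (Literature.NumberTheory.DiophantineGeometry.rad a b c : ℝ) ^ ε :=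
  fun hL hH => frey_of_face_of_nonface (face_rpow_of_polylog (stub_faceBound hL)) (stub_nonfaceOfHardCore hH)

/-- **The item from its three inputs (registered sub-goal
`fewPrimeValuationProduct_of_lfl_of_hardCore_of_residual`).** LFL input ∧ hard core ∧ non-Frey residual ⟹
`FewPrimeValuationProduct`, by the numerical Frey dictionary `crux_of_frey_of_residual` applied to
`freyFewPrime_of_lfl_of_hardCore`. A CONDITIONAL composition (its three hypotheses are the open content),
not a proof of the item. [folklore] -/
theorem fewPrimeValuationProduct_of_lfl_of_hardCore_of_residual :
    (∃ K : ℝ, 1 ≤ K ∧ Literature.NumberTheory.DiophantineGeometry.Dioph.PastenApproximationBound K) → (∀ ε : ℝ, 0 < ε → ∃ C : ℝ, ∀ p q r x y z k : ℕ, p.Prime → q.Prime → r.Prime → Odd p → Odd q → Odd r → p ≠ q → p ≠ r → q ≠ r → 0 < x → 0 < y → 0 < z → 0 < k → (p ^ x + q ^ y = 2 ^ k * r ^ z ∨ p ^ x + 2 ^ k * r ^ z = q ^ y ∨ q ^ y + 2 ^ k * r ^ z = p ^ x) → ((x * y * z * k : ℕ) : ℝ) ≤ C * ((2 * p * q * r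 : ℕ) : ℝ) ^ ε) → (∀ ε : ℝ, 0 < ε → ∃ C : ℝ, ∀ (W : WeierstrassCurve ℚ) [W.IsElliptic], (∀ p : ℕ, p.Prime → p ≠ 2 → ¬ p ^ 2 ∣ W.conductorNorm ℤ) → ((W.conductorNorm ℤ).primeFactors.filter (fun p => p ≠ 2 ∧ ¬ p ^ 2 ∣ W.conductorNorm ℤ)).card ≤ 3 → (¬ ∃ a b c : ℕ, Literature.NumberTheory.DiophantineGeometry.IsABCTriple a b c ∧ (∀ p : ℕ, p.Prime → p ≠ 2 → p ∣ a * b * c → p ∣ W.conductorNorm ℤ) ∧ (∀ p ∈ (W.conductorNorm ℤ).primeFactors, ¬ p ^ 2 ∣ W.conductorNorm ℤ → (W.minimalDiscriminantNorm ℤ).factorization p ≤ 2 * (a * b * c).factorization p)) → ((∏ p ∈ (W.conductorNorm ℤ).primeFactors with ¬ p ^ 2 ∣ W.conductorNorm ℤ, (W.minimalDiscriminantNorm ℤ).factorization p : ℕ) : ℝ) ≤ C * (W.conductorNorm ℤ : ℝ) ^ ε) → Summit.ABC.ABC.Theses.RibetTakahashiSplit.FewPrimeValuationProduct :=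
  fun hL hH hR => crux_of_frey_of_residual (freyFewPrime_of_lfl_of_hardCore hL hH) hR

/-! ## Necessity: the item implies each conjunct -/

/-- **The item implies the hard core (registered sub-goal `hardCore_of_fewPrimeValuationProduct`).** Every
hard-core solution is an abc triple on the four primes `{2, p, q, r}` with valuation product `x·y·z·k` and
radical `2pqr` (`hardCore_of_freyFewPrime`), and the item gives the Frey part
(`freyFewPrime_of_fewPrimeValuationProduct`, via the Frey curve of the triple). [folklore] -/
theorem hardCore_of_fewPrimeValuationProduct :
    Summit.ABC.ABC.Theses.RibetTakahashiSplit.FewPrimeValuationProduct → ∀ ε : ℝ, 0 < ε → ∃ C : ℝ, ∀ p q r x y z k : ℕ, p.Prime → q.Prime → r.Prime → Odd p → Odd q → Odd r → p ≠ q → p ≠ r → q ≠ r → 0 < x → 0 < y → 0 < z → 0 < k → (p ^ x + q ^ y = 2 ^ k * r ^ z ∨ p ^ x + 2 ^ k * r ^ z = q ^ y ∨ q ^ y + 2 ^ k * r ^ z = p ^ x) → ((x * y * z * k : ℕ) : ℝ) ≤ C * ((2 * p * q * r : ℕ) : ℝ) ^ ε :=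
  fun h => hardCore_of_freyFewPrime (freyFewPrime_of_fewPrimeValuationProduct h)

/-- **The item implies sub-exponential abc on four-prime triples (registered sub-goal
`subexpFour_of_fewPrimeValuationProduct`)**: `log c ≤ κ_ε rad(abc)^ε` whenever `ω(abc) ≤ 4`, by
`freyFewPrime_of_fewPrimeValuationProduct` and `subexpFour_of_freyFewPrime` (`c ≤ rad^{∏ v_p}`). [folklore] -/
theorem subexpFour_of_fewPrimeValuationProduct :
    Summit.ABC.ABC.Theses.RibetTakahashiSplit.FewPrimeValuationProduct → ∀ ε : ℝ, 0 < ε → ∃ κ : ℝ, ∀ a b c : ℕ, Literature.NumberTheory.DiophantineGeometry.IsABCTriple a b c → (a * b * c).primeFactors.card ≤ 4 → Real.log c ≤ κ * (Literature.NumberTheory.DiophantineGeometry.rad a b c : ℝ) ^ ε :=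
  fun h => subexpFour_of_freyFewPrime (freyFewPrime_of_fewPrimeValuationProduct h)

/-- **The item implies its non-Frey residual (registered sub-goal
`nonFreyResidual_of_fewPrimeValuationProduct`)**: the residual is the item restricted to the curves of its
class without a numerical Frey shadow, so the extra hypothesis is simply dropped. [folklore] -/
theorem nonFreyResidual_of_fewPrimeValuationProduct :
    Summit.ABC.ABC.Theses.RibetTakahashiSplit.FewPrimeValuationProduct → ∀ ε : ℝ, 0 < ε → ∃ C : ℝ, ∀ (W : WeierstrassCurve ℚ) [W.IsElliptic], (∀ p : ℕ, p.Prime → p ≠ 2 → ¬ p ^ 2 ∣ W.conductorNorm ℤ) → ((W.conductorNorm ℤ).primeFactors.filter (fun p => p ≠ 2 ∧ ¬ p ^ 2 ∣ W.conductorNorm ℤ)).card ≤ 3 → (¬ ∃ a b c : ℕ, Literature.NumberTheory.DiophantineGeometry.IsABCTriple a b c ∧ (∀ p : ℕ, p.Prime → p ≠ 2 → p ∣ a * b * c → p ∣ W.conductorNorm ℤ) ∧ (∀ p ∈ (W.conductorNorm ℤ).primeFactors, ¬ p ^ 2 ∣ W.conductorNorm ℤ → (W.minimalDiscriminantNorm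 ℤ).factorization p ≤ 2 * (a * b * c).factorization p)) → ((∏ p ∈ (W.conductorNorm ℤ).primeFactors with ¬ p ^ 2 ∣ W.conductorNorm ℤ, (W.minimalDiscriminantNorm ℤ).factorization p : ℕ) : ℝ) ≤ C * (W.conductorNorm ℤ : ℝ) ^ ε := by
  intro h ε hε
  obtain ⟨C, hC⟩ := h ε hε
  refine ⟨C, ?_⟩
  intro W _ hss hcard _
  exact hC W hss hcard

/-! ## The unconditional decomposition: four-prime sub-exponential abc ∧ residual -/

/-- **The item from four-prime sub-exponential abc and the residual (registered sub-goal
`fewPrimeValuationProduct_of_subexpFour_of_residual`).** `log c ≤ κ_ε rad^ε` on four-prime triples gives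
the Frey part (`freyFewPrime_of_subexpFour`: `∏ v_p ≤ max(log(abc)/log 2, 1)^4`), and the numerical Frey
dictionary `crux_of_frey_of_residual` does the rest. No LFL input is needed in this form. [folklore] -/
theorem fewPrimeValuationProduct_of_subexpFour_of_residual :
    (∀ ε : ℝ, 0 < ε → ∃ κ : ℝ, ∀ a b c : ℕ, Literature.NumberTheory.DiophantineGeometry.IsABCTriple a b c → (a * b * c).primeFactors.card ≤ 4 → Real.log c ≤ κ * (Literature.NumberTheory.DiophantineGeometry.rad a b c : ℝ) ^ ε) → (∀ ε : ℝ, 0 < ε → ∃ C : ℝ, ∀ (W : WeierstrassCurve ℚ) [W.IsElliptic], (∀ p : ℕ, p.Prime → p ≠ 2 → ¬ p ^ 2 ∣ W.conductorNorm ℤ) → ((W.conductorNorm ℤ).primeFactors.filter (fun p => p ≠ 2 ∧ ¬ p ^ 2 ∣ W.conductorNorm ℤ)).card ≤ 3 → (¬ ∃ a b c : ℕ, Literature.NumberTheory.DiophantineGeometry.IsABCTriple a b c ∧ (∀ p : ℕ, p.Prime → p ≠ 2 → p ∣ a * b * c → p ∣ W.conductorNorm ℤ) ∧ (∀ p ∈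 (W.conductorNorm ℤ).primeFactors, ¬ p ^ 2 ∣ W.conductorNorm ℤ → (W.minimalDiscriminantNorm ℤ).factorization p ≤ 2 * (a * b * c).factorization p)) → ((∏ p ∈ (W.conductorNorm ℤ).primeFactors with ¬ p ^ 2 ∣ W.conductorNorm ℤ, (W.minimalDiscriminantNorm ℤ).factorization p : ℕ) : ℝ) ≤ C * (W.conductorNorm ℤ : ℝ) ^ ε) → Summit.ABC.ABC.Theses.RibetTakahashiSplit.FewPrimeValuationProduct :=
  fun hS hR => crux_of_frey_of_residual (freyFewPrime_of_subexpFour hS) hR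

/-- **Unconditional decomposition of the item (registered sub-goal
`fewPrimeValuationProduct_iff_subexpFour_and_residual`).**
`FewPrimeValuationProduct ⟺ SubexpABC|_{ω(abc) ≤ 4} ∧ NonFreyResidual`: the few-prime valuation-product
bound is exactly sub-exponential abc on the triples with at most four prime factors together with the bound
on the curves of the class that have no numerical Frey shadow. Both conjuncts are open. [folklore] -/
theorem fewPrimeValuationProduct_iff_subexpFour_and_residual :
    Summit.ABC.ABC.Theses.RibetTakahashiSplit.FewPrimeValuationProduct ↔ ((∀ ε : ℝ, 0 < ε → ∃ κ : ℝ, ∀ a b c : ℕ, Literature.NumberTheory.DiophantineGeometry.IsABCTriple a b c → (a * b * c).primeFactors.card ≤ 4 → Real.log c ≤ κ * (Literature.NumberTheory.DiophantineGeometry.rad a b c : ℝ) ^ ε) ∧ (∀ ε : ℝ, 0 < ε → ∃ C : ℝ, ∀ (W : WeierstrassCurve ℚ) [W.IsElliptic], (∀ p : ℕ, p.Prime → p ≠ 2 → ¬ p ^ 2 ∣ W.conductorNorm ℤ) → ((W.conductorNorm ℤ).primeFactors.filter (fun p => p ≠ 2 ∧ ¬ p ^ 2 ∣ W.conductorNorm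 ℤ)).card ≤ 3 → (¬ ∃ a b c : ℕ, Literature.NumberTheory.DiophantineGeometry.IsABCTriple a b c ∧ (∀ p : ℕ, p.Prime → p ≠ 2 → p ∣ a * b * c → p ∣ W.conductorNorm ℤ) ∧ (∀ p ∈ (W.conductorNorm ℤ).primeFactors, ¬ p ^ 2 ∣ W.conductorNorm ℤ → (W.minimalDiscriminantNorm ℤ).factorization p ≤ 2 * (a * b * c).factorization p)) → ((∏ p ∈ (W.conductorNorm ℤ).primeFactors with ¬ p ^ 2 ∣ W.conductorNorm ℤ, (W.minimalDiscriminantNorm ℤ).factorization p : ℕ) : ℝ) ≤ C * (W.conductorNorm ℤ : ℝ) ^ ε)) :=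
  ⟨fun h => ⟨subexpFour_of_fewPrimeValuationProduct h, nonFreyResidual_of_fewPrimeValuationProduct h⟩,
    fun h => fewPrimeValuationProduct_of_subexpFour_of_residual h.1 h.2⟩

/-! ## The same against the route crux `FewPrimeHardCore` (stmt-ABC-15197) by name -/

/-- **r4 ⟹ r4H by name**: the item `FewPrimeValuationProduct` (stmt-ABC-1563) implies the route crux
`Summit.ABC.ABC.Theses.RibetTakahashiSplit.FewPrimeHardCore` (stmt-ABC-15197), which is the hard-core
statement verbatim. So no proof of the item can avoid proving that crux. [folklore] -/
theorem fewPrimeHardCore_of_fewPrimeValuationProduct :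
    Summit.ABC.ABC.Theses.RibetTakahashiSplit.FewPrimeValuationProduct →
      Summit.ABC.ABC.Theses.RibetTakahashiSplit.FewPrimeHardCore :=
  fun h => hardCore_of_fewPrimeValuationProduct h

/-- **r4 from LFL ∧ r4H ∧ residual, by name**: the LFL input, the route crux `FewPrimeHardCore`
(stmt-ABC-15197) and the non-Frey residual imply the item `FewPrimeValuationProduct`. [folklore] -/
theorem fewPrimeValuationProduct_of_lfl_of_fewPrimeHardCore_of_residual :
    (∃ K : ℝ, 1 ≤ K ∧ Literature.NumberTheory.DiophantineGeometry.Dioph.PastenApproximationBound K) →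
    Summit.ABC.ABC.Theses.RibetTakahashiSplit.FewPrimeHardCore →
    (∀ ε : ℝ, 0 < ε → ∃ C : ℝ, ∀ (W : WeierstrassCurve ℚ) [W.IsElliptic], (∀ p : ℕ, p.Prime → p ≠ 2 → ¬ p ^ 2 ∣ W.conductorNorm ℤ) → ((W.conductorNorm ℤ).primeFactors.filter (fun p => p ≠ 2 ∧ ¬ p ^ 2 ∣ W.conductorNorm ℤ)).card ≤ 3 → (¬ ∃ a b c : ℕ, Literature.NumberTheory.DiophantineGeometry.IsABCTriple a b c ∧ (∀ p : ℕ, p.Prime → p ≠ 2 → p ∣ a * b * c → p ∣ W.conductorNorm ℤ) ∧ (∀ p ∈ (W.conductorNorm ℤ).primeFactors, ¬ p ^ 2 ∣ W.conductorNorm ℤ → (W.minimalDiscriminantNorm ℤ).factorization p ≤ 2 * (a * b * c).factorization p)) → ((∏ p ∈ (W.conductorNorm ℤ).primeFactors with ¬ p ^ 2 ∣ W.conductorNorm ℤ, (W.minimalDiscriminantNorm ℤ).factorization p : ℕ) : ℝ) ≤ C * (W.conductorNorm ℤ : ℝ) ^ ε) →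
    Summit.ABC.ABC.Theses.RibetTakahashiSplit.FewPrimeValuationProduct :=
  fun hL hH hR => fewPrimeValuationProduct_of_lfl_of_hardCore_of_residual hL hH hR

/-- **The decomposition modulo the LFL input, by name**: given `∃ K ≥ 1, PastenApproximationBound K`
(Matveev + Yu over `ℚ` in Pasten's form), `FewPrimeValuationProduct ⟺ FewPrimeHardCore ∧ NonFreyResidual`
— the item (stmt-ABC-1563) is the route crux r4H (stmt-ABC-15197) together with the residual bound on the
curves of the class without a numerical Frey shadow. [folklore] -/
theorem fewPrimeValuationProduct_iff_fewPrimeHardCore_and_residual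
    (hL : ∃ K : ℝ, 1 ≤ K ∧ Literature.NumberTheory.DiophantineGeometry.Dioph.PastenApproximationBound K) :
    Summit.ABC.ABC.Theses.RibetTakahashiSplit.FewPrimeValuationProduct ↔
      (Summit.ABC.ABC.Theses.RibetTakahashiSplit.FewPrimeHardCore ∧
        (∀ ε : ℝ, 0 < ε → ∃ C : ℝ, ∀ (W : WeierstrassCurve ℚ) [W.IsElliptic], (∀ p : ℕ, p.Prime → p ≠ 2 → ¬ p ^ 2 ∣ W.conductorNorm ℤ) → ((W.conductorNorm ℤ).primeFactors.filter (fun p => p ≠ 2 ∧ ¬ p ^ 2 ∣ W.conductorNorm ℤ)).card ≤ 3 → (¬ ∃ a b c : ℕ, Literature.NumberTheory.DiophantineGeometry.IsABCTriple a b c ∧ (∀ p : ℕ, p.Prime → p ≠ 2 → p ∣ a * b * c → p ∣ W.conductorNorm ℤ) ∧ (∀ p ∈ (W.conductorNorm ℤ).primeFactors, ¬ p ^ 2 ∣ W.conductorNorm ℤ → (W.minimalDiscriminantNorm ℤ).factorization p ≤ 2 * (a * b * c).factorization p)) → ((∏ p ∈ (W.conductorNorm ℤ).primeFactors with ¬ p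 ^ 2 ∣ W.conductorNorm ℤ, (W.minimalDiscriminantNorm ℤ).factorization p : ℕ) : ℝ) ≤ C * (W.conductorNorm ℤ : ℝ) ^ ε)) :=
  ⟨fun h => ⟨fewPrimeHardCore_of_fewPrimeValuationProduct h, nonFreyResidual_of_fewPrimeValuationProduct h⟩,
    fun h => fewPrimeValuationProduct_of_lfl_of_fewPrimeHardCore_of_residual hL h.1 h.2⟩

/-- **The decomposition from the named fact (CONDITIONAL).** From the unproved Literature fact
`Dioph.evertseGyory_thm_4_2_1_rat` (Evertse–Győry 2015, Thm 4.2.1 over `ℚ`; in the tree it yields the LFL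
input through `stub_lflInput_of_evertseGyory`), `FewPrimeValuationProduct ⟺ FewPrimeHardCore ∧ NonFreyResidual`.
This theorem is conditional on that named fact and records nothing more. [folklore] -/
theorem fewPrimeValuationProduct_iff_fewPrimeHardCore_and_residual_of_evertseGyory
    (hEG : Literature.NumberTheory.DiophantineGeometry.Dioph.evertseGyory_thm_4_2_1_rat) :
    Summit.ABC.ABC.Theses.RibetTakahashiSplit.FewPrimeValuationProduct ↔
      (Summit.ABC.ABC.Theses.RibetTakahashiSplit.FewPrimeHardCore ∧
        (∀ ε : ℝ, 0 < ε → ∃ C : ℝ, ∀ (W : WeierstrassCurve ℚ) [W.IsElliptic], (∀ p : ℕ, p.Prime → p ≠ 2 → ¬ p ^ 2 ∣ W.conductorNorm ℤ) → ((W.conductorNorm ℤ).primeFactors.filter (fun p => p ≠ 2 ∧ ¬ p ^ 2 ∣ W.conductorNorm ℤ)).card ≤ 3 → (¬ ∃ a b c : ℕ, Literature.NumberTheory.DiophantineGeometry.IsABCTriple a b c ∧ (∀ p : ℕ, p.Prime → p ≠ 2 → p ∣ a * b * c → p ∣ W.conductorNorm ℤ) ∧ (∀ p ∈ (W.conductorNorm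 ℤ).primeFactors, ¬ p ^ 2 ∣ W.conductorNorm ℤ → (W.minimalDiscriminantNorm ℤ).factorization p ≤ 2 * (a * b * c).factorization p)) → ((∏ p ∈ (W.conductorNorm ℤ).primeFactors with ¬ p ^ 2 ∣ W.conductorNorm ℤ, (W.minimalDiscriminantNorm ℤ).factorization p : ℕ) : ℝ) ≤ C * (W.conductorNorm ℤ : ℝ) ^ ε)) :=
  fewPrimeValuationProduct_iff_fewPrimeHardCore_and_residual (stub_lflInput_of_evertseGyory hEG)

end Summit.ABC.ABC.Theorems.FewPrimeValuationProduct

end
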